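import Literature.NumberTheory.Automorphic.BorelHeckeLocalGL2
import HarnessLib

/-!
# The `q` cosets of `(B ∩ K) diag(1,ϖ)⁻¹ (B ∩ K)`: the degree of the Borel push-forward operator

Topic `NumberTheory/Automorphic`; namespace `Literature.NumberTheory.Automorphic`.  Local,
continuing `BorelHeckeLocalGL2` (`K = GL₂(𝒪)`, `B` upper triangular, `t₂ = diag(1, ϖ)`,
`n(x) = (1 x; 0 1)`):

* `coe_heckeLocalDiag'_conj` — `t₂ (a b; 0 d) t₂⁻¹ = (a b/ϖ; 0 d)`;
* `exists_upperRight_mul_heckeLocalDiag'_inv_coset_eq` — for `l ∈ B ∩ K` there is a residue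
  representative `b_i` with `l t₂⁻¹ K = n(b_i) t₂⁻¹ K`;
* `upperRight_mul_heckeLocalDiag'_inv_coset_injective` — the cosets `n(b_i) t₂⁻¹ K` are pairwise
  distinct.

So `{l t₂⁻¹ K : l ∈ B ∩ K}` has exactly `q = #(𝒪/ϖ)` elements: the Borel Hecke operator
`[(B∩K) t₂⁻¹ (B∩K)]` has degree `q`, and `[(B∩K) t₂⁻¹ (B∩K)] ∘ [(B∩K) t₂ (B∩K)] = q` on cohomology
(`HeckeContractingElement`) — the push–pull relation with the RIGHT constant `q_w = N(w)` needed
for the Hecke polynomial `X² − a_{w,1} X + N(w) a_{w,2}` of a boundary eigenclass [Harder1987, §2].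

## References

* G. Harder, *Eisenstein cohomology of arithmetic groups. The case GL₂*, Invent. Math. 89 (1987), §2
  [Harder1987].
* D. Bump, *Automorphic forms and representations* (1997), §4.6 [Bump1997].
-/

noncomputable section

open Matrix.GeneralLinearGroup

namespace Literature.NumberTheory.Automorphic

section Borel

variable {F : Type*} [Field F] (ϖ : F) (hϖ0 : ϖ ≠ 0)

/-- `t₂ (a b; 0 d) t₂⁻¹ = (a b/ϖ; 0 d)`. [folklore] -/
theorem coe_heckeLocalDiag'_conj {l : GL (Fin 2) F} (hl : l ∈ borelGL2 F) :
    ((heckeLocalDiag' ϖ hϖ0 * l * (heckeLocalDiag' ϖ hϖ0)⁻¹ : GL (Fin 2) F) :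
        Matrix (Fin 2) (Fin 2) F) =
      !![(l : Matrix (Fin 2) (Fin 2) F) 0 0, (l : Matrix (Fin 2) (Fin 2) F) 0 1 * ϖ⁻¹;
        0, (l : Matrix (Fin 2) (Fin 2) F) 1 1] := by
  have key : ∀ a : F, ϖ * a * ϖ⁻¹ = a := fun a => by
    rw [mul_right_comm, mul_inv_cancel₀ hϖ0, one_mul]
  rw [Units.val_mul, Units.val_mul, coe_heckeLocalDiag'_inv, coe_heckeLocalDiag',
    coe_eq_of_mem_borelGL2 hl]
  ext r c; fin_cases r <;> fin_cases c <;>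
    simp [Matrix.mul_apply, Fin.sum_univ_two, key]

/-- `n(-β) (a b; 0 d) = (a, b - β d; 0, d)` lies in `B`. [folklore] -/
theorem upperRightHom_mul_mem_borelGL2 (β : F) {l : GL (Fin 2) F} (hl : l ∈ borelGL2 F) :
    (upperRightHom β : GL (Fin 2) F) * l ∈ borelGL2 F :=
  mul_mem (upperRightHom_mem_borelGL2 β) hl

/-- Entries of `n(β) (a b; 0 d) = (a, b + β d; 0, d)`. [folklore] -/
theorem coe_upperRightHom_mul {β : F} {l : GL (Fin 2) F} (hl : l ∈ borelGL2 F) :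
    (((upperRightHom β : GL (Fin 2) F) * l : GL (Fin 2) F) : Matrix (Fin 2) (Fin 2) F) =
      !![(l : Matrix (Fin 2) (Fin 2) F) 0 0,
          (l : Matrix (Fin 2) (Fin 2) F) 0 1 + β * (l : Matrix (Fin 2) (Fin 2) F) 1 1;
        0, (l : Matrix (Fin 2) (Fin 2) F) 1 1] := by
  rw [Units.val_mul, upperRightHom_apply, coe_eq_of_mem_borelGL2 hl]
  ext r c; fin_cases r <;> fin_cases c <;> simp [Matrix.mul_apply, Fin.sum_univ_two]

/-- `(n(β) t₂⁻¹)⁻¹ (l t₂⁻¹) = t₂ (n(-β) l) t₂⁻¹`, in `GL₂(F)`. [folklore] -/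
theorem inv_mul_eq_conj (β : F) (l : GL (Fin 2) F) :
    ((upperRightHom β : GL (Fin 2) F) * (heckeLocalDiag' ϖ hϖ0)⁻¹)⁻¹ * (l * (heckeLocalDiag' ϖ hϖ0)⁻¹) =
      heckeLocalDiag' ϖ hϖ0 * ((upperRightHom (-β) : GL (Fin 2) F) * l) * (heckeLocalDiag' ϖ hϖ0)⁻¹ := by
  rw [AddChar.map_neg_eq_inv]
  group

end Borel

section Valued

variable {F : Type*} [Field F] [Valued F (WithZero (Multiplicative ℤ))]
variable (ϖ : F) {ι : Type*} (b : ι → F) (hϖ0 : ϖ ≠ 0)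

/-- Dividing an element of `𝓂` by `ϖ` keeps it integral. [folklore] -/
theorem valuation_mul_inv_le_one (hϖ : Valued.v ϖ = WithZero.exp (-1 : ℤ)) {x : F}
    (hx : Valued.v x < 1) : Valued.v (x * ϖ⁻¹) ≤ 1 := by
  have hvϖ : Valued.v ϖ ≠ 0 := by rw [hϖ]; exact WithZero.coe_ne_zero
  rw [Valuation.map_mul, map_inv₀]
  calc Valued.v x * (Valued.v ϖ)⁻¹ ≤ Valued.v ϖ * (Valued.v ϖ)⁻¹ :=
        mul_le_mul' (valuation_le_of_lt_one hϖ hx) le_rfl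
    _ = 1 := mul_inv_cancel₀ hvϖ

/-- **`l t₂⁻¹ K = n(b_i) t₂⁻¹ K` for some residue representative `b_i`** (`l = (a b; 0 d) ∈ B ∩ K`;
take `b_i ≡ b/d`: then `(n(b_i) t₂⁻¹)⁻¹ l t₂⁻¹ = (a, (b - b_i d)/ϖ; 0, d) ∈ K`).
[cite: Bump1997, §4.6] [cite: Harder1987, §2] -/
theorem exists_upperRight_mul_heckeLocalDiag'_inv_coset_eq (hϖ : Valued.v ϖ = WithZero.exp (-1 : ℤ))
    (hb : ∀ x : F, Valued.v x ≤ 1 → ∃ i, Valued.v (x - b i) < 1)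
    {l : GL (Fin 2) F} (hlB : l ∈ borelGL2 F) (hlK : l ∈ GL2Int F) :
    ∃ i : ι, ((l * (heckeLocalDiag' ϖ hϖ0)⁻¹ : GL (Fin 2) F) : GL (Fin 2) F ⧸ GL2Int F) =
      (((upperRightHom (b i) : GL (Fin 2) F) * (heckeLocalDiag' ϖ hϖ0)⁻¹ : GL (Fin 2) F) :
        GL (Fin 2) F ⧸ GL2Int F) := by
  obtain ⟨ha, hd⟩ := valuation_diag_eq_one_of_mem hlB hlK
  have hdet := valuation_det_eq_one_of_mem hlK
  rw [det_fin_two_val, (mem_borelGL2_iff).1 hlB, mul_zero, sub_zero] at hdet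
  obtain ⟨h1, -, -⟩ := id hlK
  set a := (l : Matrix (Fin 2) (Fin 2) F) 0 0 with ha'
  set bb := (l : Matrix (Fin 2) (Fin 2) F) 0 1 with hbb'
  set d := (l : Matrix (Fin 2) (Fin 2) F) 1 1 with hd'
  have hd0 : d ≠ 0 := fun h => by rw [h, Valuation.map_zero] at hd; exact zero_ne_one hd
  -- the residue of `b / d`
  have hbd : Valued.v (bb * d⁻¹) ≤ 1 := by
    rw [Valuation.map_mul, map_inv₀, hd, inv_one, mul_one]; exact h1 0 1
  obtain ⟨i, hi⟩ := hb _ hbd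
  refine ⟨i, ?_⟩
  rw [eq_comm, QuotientGroup.eq, inv_mul_eq_conj]
  have hmem : (upperRightHom (-b i) : GL (Fin 2) F) * l ∈ borelGL2 F :=
    upperRightHom_mul_mem_borelGL2 _ hlB
  refine mem_GL2Int_of_entries (fun r c => ?_) ?_
  · rw [coe_heckeLocalDiag'_conj ϖ hϖ0 hmem, coe_upperRightHom_mul hlB]
    have h01 : Valued.v ((bb + -b i * d) * ϖ⁻¹) ≤ 1 := by
      have : (bb * d⁻¹ - b i) * d = bb + -b i * d := by
        rw [sub_mul, mul_assoc, inv_mul_cancel₀ hd0, mul_one, sub_eq_add_neg, neg_mul]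
      rw [← this, mul_right_comm]
      rw [Valuation.map_mul, hd, mul_one]
      exact valuation_mul_inv_le_one ϖ hϖ hi
    fin_cases r <;> fin_cases c
    · simpa using h1 0 0
    · simpa using h01
    · simp
    · simpa using h1 1 1
  · rw [det_fin_two_val, coe_heckeLocalDiag'_conj ϖ hϖ0 hmem, coe_upperRightHom_mul hlB]
    simpa using hdet

/-- **The cosets `n(b_i) t₂⁻¹ K` are pairwise distinct** (`(n(b_i) t₂⁻¹)⁻¹ n(b_j) t₂⁻¹ =
(1, (b_j - b_i)/ϖ; 0, 1)`). [cite: Bump1997, §4.6] [cite: Harder1987, §2] -/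
theorem upperRight_mul_heckeLocalDiag'_inv_coset_injective (hϖ : Valued.v ϖ = WithZero.exp (-1 : ℤ))
    (hbinj : ∀ i j, Valued.v (b i - b j) < 1 → i = j) :
    Function.Injective fun i : ι =>
      ((((upperRightHom (b i) : GL (Fin 2) F) * (heckeLocalDiag' ϖ hϖ0)⁻¹ : GL (Fin 2) F)) :
        GL (Fin 2) F ⧸ GL2Int F) := by
  intro i j hij
  simp only at hij
  rw [QuotientGroup.eq, inv_mul_eq_conj] at hij
  obtain ⟨h1, -, -⟩ := hij
  have h01 := h1 0 1
  rw [coe_heckeLocalDiag'_conj ϖ hϖ0 (upperRightHom_mul_mem_borelGL2 _ (upperRightHom_mem_borelGL2 _)),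
    coe_upperRightHom_mul (upperRightHom_mem_borelGL2 _)] at h01
  simp only [upperRightHom_apply, Matrix.of_apply, Matrix.cons_val', Matrix.cons_val_zero,
    Matrix.cons_val_one, Matrix.cons_val_fin_one, mul_one] at h01
  -- `h01 : |(b j - b i) / ϖ| ≤ 1`
  have hvϖ : Valued.v ϖ ≠ 0 := (Valuation.ne_zero_iff _).2 hϖ0
  have hlt : Valued.v (b j + -b i) < 1 := by
    have h := h01
    rw [Valuation.map_mul, map_inv₀, mul_inv_le_iff₀ (zero_lt_iff.2 hvϖ), one_mul] at h
    refine lt_of_le_of_lt h ?_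
    rw [hϖ, ← WithZero.exp_zero, WithZero.exp_lt_exp]; omega
  rw [← sub_eq_add_neg] at hlt
  exact (hbinj j i hlt).symm

end Valued

end Literature.NumberTheory.Automorphic
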